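import Summits.QuantumAdvantage.QuantumAdvantage.Theorems.CubicForrelationNearExactIsExactEightTypeE
import Summits.QuantumAdvantage.QuantumAdvantage.Theorems.CubicForrelationNearExactIsExactIsolationSmallN
import Summits.QuantumAdvantage.QuantumAdvantage.Theorems.CubicForrelationNearExactIsExactTenZCount

/-!
# Crux `CubicForrelation.NearExactIsExact` (stmt-QuantumAdvantage-14043) — type E on 8 bits above `13/16`: CHARACTER, DEVIATIONS, PARITY KILL

Certificate seat `b2b-cforr-cert` (generation 2), rung `θ₈ = 13/16`.  HONEST FRAMING: a theorem about cubic Boolean functions on 8 bits (the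
finite slice `n = 8` of the crux) — NOT summit progress.  Steps T2–T3 of the type-E endgame (seat folder `PROOF-N8.md`): with
`L := [⌊v/2⌋ odd] ⊕ f` and `ℓ := (−1)^L`, FACT 1 (`te_fact1`) makes `ℓ` a `±`-character on the split flat `Z = x₀ ⊕ V₀`, so every twisted
sum `Â(y) = Σ_{x∈Z} ℓ(x)(−1)^{x·y}` is `0` or `±64` (`tee_char`); the deviation `π := v − (−1)^f + [v even]·ℓ` is a multiple of `4`
(`tee_pi_dvd`) and is paid for twice in the budget (`tee_pi_cost`), so in the window `Σ π² < 64` (`tee_pi_sq_lt`).  Steps T4–T5: the Fourier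
identity `W_f = 16(−1)^g + Â − Π` (`tef_fourier`), the parity kill of `1 ≤ #{π ≠ 0} ≤ 3` through `W_f ∈ 8ℤ` with constant parity (`tef_parity`), and
the clean kill `Σ_Z v·ℓ = −32` versus `|Σ_Z v·ℓ| ≤ 16` (`tef_clean`).  The companion `…EightThirteenSixteenths` assembles `θ₈ = 13/16`.
-/

set_option linter.dupNamespace false -- D-0017: single-problem summit ⇒ `QuantumAdvantage.QuantumAdvantage` by design

noncomputable section

namespace Summit.QuantumAdvantage.QuantumAdvantage.Theorems.CubicForrelation.NearExactIsExact

open Finset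
open Literature.Computability.QuantumComplexity
open Literature.Computability.QuantumComplexity.BuzetChailloux (bxor zeroVec bxor_bxor_cancel_left bxor_zeroVec zeroVec_bxor bxor_comm
  bxor_self twist_zeroVec_right bxor_eq_zeroVec_iff signOf_sq)
open Literature.Computability.QuantumComplexity.DerivativeWalsh (W twist_bxor_left sum_W_sq)

/-- Sign form of a vanishing fourfold xor. [folklore] -/
theorem tee_sign4 (l₀ l₁ l₂ l₃ : Bool) (h : (l₀ ^^ l₁ ^^ l₂ ^^ l₃) = false) : sZ l₃ * sZ l₀ = sZ l₁ * sZ l₂ := by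
  revert h; cases l₀ <;> cases l₁ <;> cases l₂ <;> cases l₃ <;> simp [sZ]

/-- **The character (T2).** Every twisted sum of `ℓ = (−1)^L` over the flat `x₀ ⊕ V₀` is `0` or `±64`. [this work] -/
theorem tee_char (f g : (Fin (4 + 4) → Bool) → Bool) (hf : IsDegLeFun 3 f) (hg : IsDegLeFun 3 g)
    (v : (Fin (4 + 4) → Bool) → ℤ) (hv : ∀ x, W (fun y => signOf (g y)) x = (2 : ℝ) ^ 4 * (v x : ℝ))
    (V₀ : Finset (Fin (4 + 4) → Bool)) (x₀ : Fin (4 + 4) → Bool) (h0 : zeroVec ∈ V₀)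
    (hadd : ∀ a ∈ V₀, ∀ b ∈ V₀, bxor a b ∈ V₀) (hcard : #V₀ = 64)
    (hZ : (univ.filter fun x => ¬ Odd (v x)) = V₀.image (bxor x₀))
    (hfp : ∀ x, Odd (v x) → f x = decide (Odd (v x / 2))) (y : Fin (4 + 4) → Bool) :
    ∃ r : ℤ, (r = 0 ∨ r = 1 ∨ r = -1) ∧
      ∑ c ∈ V₀, (sZ (decide (Odd (v (bxor x₀ c) / 2)) ^^ f (bxor x₀ c)) : ℝ) * twist (bxor x₀ c) y = (r : ℝ) * 64 := by
  have hx₀ : ¬ Odd (v x₀) := (ep_even_iff v V₀ x₀ hZ x₀).2 (by rw [bxor_self]; exact h0)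
  obtain ⟨r, hr, hsum⟩ := tep_char_coset V₀ h0 hadd x₀ (fun y => (sZ (decide (Odd (v y / 2)) ^^ f y) : ℝ))
    (fun c _ => by
      rcases tp_sZ_cases (decide (Odd (v (bxor x₀ c) / 2)) ^^ f (bxor x₀ c)) with h | h <;> simp [h])
    (fun c hc c' hc' => by
      have h4 := te_fact1 f g hf hg v hv V₀ x₀ h0 hadd hcard hZ hfp hx₀ hc' hc
      have e1 : (fun j => x₀ j ^^ c j) = bxor x₀ c := rfl
      have e2 : (fun j => x₀ j ^^ c' j) = bxor x₀ c' := rfl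
      have e3 : (fun j => x₀ j ^^ c j ^^ c' j) = bxor x₀ (bxor c c') := by
        funext j; show ((x₀ j ^^ c j) ^^ c' j) = (x₀ j ^^ (c j ^^ c' j)); rw [Bool.xor_assoc]
      rw [e1, e2, e3] at h4
      exact_mod_cast tee_sign4 _ _ _ _ h4) y
  rcases hr with h | h | h
  · exact ⟨0, Or.inl rfl, by rw [hsum, h]; simp⟩
  · exact ⟨1, Or.inr (Or.inl rfl), by rw [hsum, h, hcard]; norm_num⟩
  · exact ⟨-1, Or.inr (Or.inr rfl), by rw [hsum, h, hcard]; norm_num⟩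

/-! ### The deviation `π` -/

/-- `sZ` is multiplicative for xor. [folklore] -/
theorem tee_sZ_xor (a b : Bool) : sZ (a ^^ b) = sZ a * sZ b := by
  cases a <;> cases b <;> simp [sZ]

/-- **`4 ∣ π` (T3 i).** [this work] -/
theorem tee_pi_dvd (f : (Fin (4 + 4) → Bool) → Bool) (v : (Fin (4 + 4) → Bool) → ℤ)
    (hfp : ∀ x, Odd (v x) → f x = decide (Odd (v x / 2))) (y : Fin (4 + 4) → Bool) :
    (4 : ℤ) ∣ v y - sZ (f y) + (if Odd (v y) then 0 else sZ (decide (Odd (v y / 2)) ^^ f y)) := by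
  have hm := tep_mod_four (v y)
  have hsf : sZ false = 1 := rfl
  have hst : sZ true = -1 := rfl
  by_cases ho : Odd (v y)
  · rw [if_pos ho] at hm ⊢
    rw [hfp y ho]
    by_cases hq : Odd (v y / 2)
    · rw [if_pos hq] at hm; rw [decide_eq_true hq, hst]; exact ⟨v y / 2 / 2 + 1, by omega⟩
    · rw [if_neg hq] at hm; rw [decide_eq_false hq, hsf]; exact ⟨v y / 2 / 2, by omega⟩
  · rw [if_neg ho] at hm ⊢
    rw [tee_sZ_xor]
    by_cases hq : Odd (v y / 2)
    · rw [if_pos hq] at hm; rw [decide_eq_true hq, hst]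
      rcases tp_sZ_cases (f y) with h | h <;> rw [h]
      · exact ⟨v y / 2 / 2, by omega⟩
      · exact ⟨v y / 2 / 2 + 1, by omega⟩
    · rw [if_neg hq] at hm; rw [decide_eq_false hq, hsf]
      rcases tp_sZ_cases (f y) with h | h <;> rw [h] <;> exact ⟨v y / 2 / 2, by omega⟩

/-- **`π` is paid for in the budget (T3 ii):** `2(v − s)² ≥ 2[v even] + π²`. [this work] -/
theorem tee_pi_cost (f : (Fin (4 + 4) → Bool) → Bool) (v : (Fin (4 + 4) → Bool) → ℤ) (y : Fin (4 + 4) → Bool) :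
    2 * (if Odd (v y) then (0 : ℤ) else 1) +
      (v y - sZ (f y) + (if Odd (v y) then 0 else sZ (decide (Odd (v y / 2)) ^^ f y))) ^ 2 ≤ 2 * (v y - sZ (f y)) ^ 2 := by
  have h0 := td_two_mul_div_add (v y)
  have hsf : sZ false = 1 := rfl
  have hst : sZ true = -1 := rfl
  by_cases ho : Odd (v y)
  · rw [if_pos ho, if_pos ho]; nlinarith [sq_nonneg (v y - sZ (f y))]
  · rw [if_neg ho] at h0
    rw [if_neg ho, if_neg ho, tee_sZ_xor]
    have hs := tp_sZ_cases (f y)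
    by_cases hq : Odd (v y / 2)
    · rw [decide_eq_true hq, hst]
      have h1 := Int.odd_iff.1 hq
      have hw : v y / 2 ≤ -1 ∨ 1 ≤ v y / 2 := by omega
      rcases hs with h | h <;> rw [h] <;> rcases hw with hw | hw <;> nlinarith
    · rw [decide_eq_false hq, hsf]
      have h1 : v y / 2 % 2 = 0 := Int.even_iff.1 (Int.not_odd_iff_even.1 hq)
      have hw : v y / 2 ≤ -2 ∨ v y / 2 = 0 ∨ 2 ≤ v y / 2 := by omega
      rcases hs with h | h <;> rw [h] <;> rcases hw with hw | hw | hw <;> nlinarith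

/-- **`Σ π² < 64` in the window (T3 iii).** [this work] -/
theorem tee_pi_sq_lt (f g : (Fin (4 + 4) → Bool) → Bool) (v : (Fin (4 + 4) → Bool) → ℤ)
    (hv : ∀ x, W (fun y => signOf (g y)) x = (2 : ℝ) ^ 4 * (v x : ℝ)) (hΦ : 13 / 16 < forrelation f g)
    (hN : #(univ.filter fun x => Odd (v x)) = 192) :
    ∑ y, (v y - sZ (f y) + (if Odd (v y) then 0 else sZ (decide (Odd (v y / 2)) ^^ f y))) ^ 2 < (64 : ℤ) := by
  have hT := el_budget4 f g v hv hΦ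
  have hsum := sum_le_sum fun y (_ : y ∈ (univ : Finset (Fin (4 + 4) → Bool))) => tee_pi_cost f v y
  rw [sum_add_distrib, ← mul_sum, ← mul_sum, sum_ite, sum_const_zero, zero_add, sum_const, nsmul_eq_mul, mul_one] at hsum
  have h64 : #(univ.filter fun x : Fin (4 + 4) → Bool => ¬ Odd (v x)) = 64 := by
    have := card_filter_add_card_filter_not (s := (univ : Finset (Fin (4 + 4) → Bool))) (fun x => Odd (v x))
    rw [hN, card_univ, Fintype.card_fun, Fintype.card_bool, Fintype.card_fin] at this
    simp only [Nat.reducePow, Nat.reduceAdd] at this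
    exact Nat.add_left_cancel (this.trans (by norm_num))
  rw [h64] at hsum
  push_cast at hsum
  linarith

/-- Consequences: every `π ∈ {0, ±4}` and at most three are non-zero. [this work] -/
theorem tee_pi_shape (f g : (Fin (4 + 4) → Bool) → Bool) (v : (Fin (4 + 4) → Bool) → ℤ)
    (hv : ∀ x, W (fun y => signOf (g y)) x = (2 : ℝ) ^ 4 * (v x : ℝ)) (hΦ : 13 / 16 < forrelation f g)
    (hN : #(univ.filter fun x => Odd (v x)) = 192) (hfp : ∀ x, Odd (v x) → f x = decide (Odd (v x / 2))) :
    (∀ y, (v y - sZ (f y) + (if Odd (v y) then 0 else sZ (decide (Odd (v y / 2)) ^^ f y))) = 0 ∨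
      (v y - sZ (f y) + (if Odd (v y) then 0 else sZ (decide (Odd (v y / 2)) ^^ f y))) = 4 ∨
      (v y - sZ (f y) + (if Odd (v y) then 0 else sZ (decide (Odd (v y / 2)) ^^ f y))) = -4) ∧
    #(univ.filter fun y => (v y - sZ (f y) + (if Odd (v y) then 0 else sZ (decide (Odd (v y / 2)) ^^ f y))) ≠ 0) ≤ 3 := by
  have hlt := tee_pi_sq_lt f g v hv hΦ hN
  have hnn : ∀ y ∈ (univ : Finset (Fin (4 + 4) → Bool)),
      (0 : ℤ) ≤ (v y - sZ (f y) + (if Odd (v y) then 0 else sZ (decide (Odd (v y / 2)) ^^ f y))) ^ 2 := fun y _ => sq_nonneg _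
  have hpt : ∀ y, (v y - sZ (f y) + (if Odd (v y) then 0 else sZ (decide (Odd (v y / 2)) ^^ f y))) ^ 2 < 64 :=
    fun y => lt_of_le_of_lt (single_le_sum hnn (mem_univ y)) hlt
  refine ⟨fun y => ?_, ?_⟩
  · obtain ⟨k, hk⟩ := tee_pi_dvd f v hfp y
    have h := hpt y
    rw [hk] at h ⊢
    have hk2 : k ^ 2 < 4 := by nlinarith
    have hk1 : -1 ≤ k ∧ k ≤ 1 := by constructor <;> nlinarith
    have : k = 0 ∨ k = 1 ∨ k = -1 := by omega
    rcases this with rfl | rfl | rfl <;> simp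
  · by_contra hgt
    push Not at hgt
    have h16 : ∀ y ∈ univ.filter (fun y => (v y - sZ (f y) +
        (if Odd (v y) then 0 else sZ (decide (Odd (v y / 2)) ^^ f y))) ≠ 0),
        (16 : ℤ) ≤ (v y - sZ (f y) + (if Odd (v y) then 0 else sZ (decide (Odd (v y / 2)) ^^ f y))) ^ 2 := by
      intro y hy
      obtain ⟨k, hk⟩ := tee_pi_dvd f v hfp y
      have hne := (mem_filter.1 hy).2
      rw [hk] at hne ⊢
      have hk0 : k ≠ 0 := fun h => hne (by rw [h]; ring)
      have : k ≤ -1 ∨ 1 ≤ k := by omega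
      rcases this with h | h <;> nlinarith
    have hle := sum_le_sum h16
    rw [sum_const, nsmul_eq_mul] at hle
    have hsub := sum_le_sum_of_subset_of_nonneg (filter_subset (fun y => (v y - sZ (f y) +
        (if Odd (v y) then 0 else sZ (decide (Odd (v y / 2)) ^^ f y))) ≠ 0) univ) (fun y _ _ => hnn y (mem_univ y))
    have h4 : (4 : ℤ) ≤ #(univ.filter fun y => (v y - sZ (f y) +
        (if Odd (v y) then 0 else sZ (decide (Odd (v y / 2)) ^^ f y))) ≠ 0) := by exact_mod_cast hgt
    nlinarith

/-! ### T4–T5: Fourier identity, parity kill, clean kill -/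

/-- The twisted sum of `[v even]·ℓ` is the coset character sum `Â`. [this work] -/
theorem tef_W_flat (f : (Fin (4 + 4) → Bool) → Bool) (v : (Fin (4 + 4) → Bool) → ℤ) (V₀ : Finset (Fin (4 + 4) → Bool))
    (x₀ : Fin (4 + 4) → Bool) (hZ : (univ.filter fun x => ¬ Odd (v x)) = V₀.image (bxor x₀)) (y : Fin (4 + 4) → Bool) :
    ∑ x, ((if Odd (v x) then (0 : ℤ) else sZ (decide (Odd (v x / 2)) ^^ f x)) : ℝ) * twist x y =
      ∑ c ∈ V₀, (sZ (decide (Odd (v (bxor x₀ c) / 2)) ^^ f (bxor x₀ c)) : ℝ) * twist (bxor x₀ c) y := by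
  classical
  have e : ∀ x, ((if Odd (v x) then (0 : ℤ) else sZ (decide (Odd (v x / 2)) ^^ f x)) : ℝ) * twist x y =
      if ¬ Odd (v x) then (sZ (decide (Odd (v x / 2)) ^^ f x) : ℝ) * twist x y else 0 := by
    intro x; by_cases h : Odd (v x) <;> simp [h]
  rw [sum_congr rfl fun x _ => e x, ← sum_filter, hZ, sum_image fun a _ b _ hab => by
    simpa only [bxor_bxor_cancel_left] using congrArg (bxor x₀) hab]

/-- **The Fourier identity (T4):** `W_f(y) = 16(−1)^{g(y)} + Â(y) − Σ_x π(x)(−1)^{x·y}`. [this work] -/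
theorem tef_fourier (f g : (Fin (4 + 4) → Bool) → Bool) (v : (Fin (4 + 4) → Bool) → ℤ)
    (hv : ∀ x, W (fun y => signOf (g y)) x = (2 : ℝ) ^ 4 * (v x : ℝ)) (V₀ : Finset (Fin (4 + 4) → Bool))
    (x₀ : Fin (4 + 4) → Bool) (hZ : (univ.filter fun x => ¬ Odd (v x)) = V₀.image (bxor x₀)) (y : Fin (4 + 4) → Bool) :
    W (fun x => signOf (f x)) y = 16 * signOf (g y) +
      ∑ c ∈ V₀, (sZ (decide (Odd (v (bxor x₀ c) / 2)) ^^ f (bxor x₀ c)) : ℝ) * twist (bxor x₀ c) y -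
      ∑ x, ((v x - sZ (f x) + (if Odd (v x) then 0 else sZ (decide (Odd (v x / 2)) ^^ f x)) : ℤ) : ℝ) * twist x y := by
  have hinv := tz_inversion (fun y => signOf (g y)) y
  simp_rw [hv] at hinv
  rw [← tef_W_flat f v V₀ x₀ hZ y]
  have e : ∀ x, (((v x - sZ (f x) + (if Odd (v x) then 0 else sZ (decide (Odd (v x / 2)) ^^ f x)) : ℤ) : ℝ) * twist x y) =
      (1 / 16) * ((2 : ℝ) ^ 4 * (v x : ℝ) * twist x y) - signOf (f x) * twist x y +
        ((if Odd (v x) then (0 : ℤ) else sZ (decide (Odd (v x / 2)) ^^ f x)) : ℝ) * twist x y := by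
    intro x; push_cast; rw [tp_sZ_cast]; ring
  rw [sum_congr rfl fun x _ => e x, sum_add_distrib, sum_sub_distrib, ← mul_sum, hinv]
  unfold W
  norm_num
  ring

/-- Sums over small supports. [folklore] -/
theorem tef_sum_support (π : (Fin (4 + 4) → Bool) → ℤ) (y : Fin (4 + 4) → Bool) :
    ∑ x, ((π x : ℤ) : ℝ) * twist x y = ∑ x ∈ univ.filter (fun x => π x ≠ 0), ((π x : ℤ) : ℝ) * twist x y := by
  refine (sum_subset (filter_subset _ _) fun x _ hx => ?_).symm
  have : π x = 0 := by simpa using hx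
  rw [this]; push_cast; ring

/-- **Parity kill (T4):** with `1 ≤ #{π ≠ 0} ≤ 3` the identity `8u' = 16(−1)^g + 64r − Π` is impossible. [this work] -/
theorem tef_parity (f g : (Fin (4 + 4) → Bool) → Bool) (hf : IsDegLeFun 3 f) (π : (Fin (4 + 4) → Bool) → ℤ)
    (A : (Fin (4 + 4) → Bool) → ℝ) (hA : ∀ y, ∃ r : ℤ, (r = 0 ∨ r = 1 ∨ r = -1) ∧ A y = (r : ℝ) * 64)
    (hW : ∀ y, W (fun x => signOf (f x)) y = 16 * signOf (g y) + A y - ∑ x, ((π x : ℤ) : ℝ) * twist x y)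
    (hvals : ∀ y, π y = 0 ∨ π y = 4 ∨ π y = -4) (hcnt : #(univ.filter fun y => π y ≠ 0) ≤ 3)
    (hne : ∃ y, π y ≠ 0) : False := by
  classical
  obtain ⟨u', hu'⟩ := tw_base f hf 3 (by norm_num)
  have hpc := ed_parity_const f u' hf hu'
  -- integer form of the identity at a point
  have hE : ∀ y, ∃ r : ℤ, (r = 0 ∨ r = 1 ∨ r = -1) ∧
      ((8 * u' y : ℤ) : ℝ) = 16 * (sZ (g y) : ℝ) + (r : ℝ) * 64 - ∑ x ∈ univ.filter (fun x => π x ≠ 0), ((π x : ℤ) : ℝ) * twist x y := by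
    intro y
    obtain ⟨r, hr, hAr⟩ := hA y
    refine ⟨r, hr, ?_⟩
    have h := hW y
    rw [hu' y, hAr, tef_sum_support, ← tp_sZ_cast] at h
    push_cast at h ⊢
    linarith
  set X := univ.filter (fun y => π y ≠ 0) with hX
  have hmemX : ∀ x, x ∈ X ↔ π x ≠ 0 := fun x => by simp [hX]
  have hpm : ∀ x ∈ X, π x = 4 ∨ π x = -4 := fun x hx => ((hvals x).resolve_left ((hmemX x).1 hx))
  have hsg : ∀ y, sZ (g y) = 1 ∨ sZ (g y) = -1 := fun y => tp_sZ_cases (g y)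
  have h1 : 1 ≤ #X := by obtain ⟨y, hy⟩ := hne; exact card_pos.2 ⟨y, (hmemX y).2 hy⟩
  have hcases : #X = 1 ∨ #X = 2 ∨ #X = 3 := by omega
  rcases hcases with hc | hc | hc
  · obtain ⟨x₁, hX1⟩ := card_eq_one.1 hc
    have hx₁ := hpm x₁ (by rw [hX1]; exact mem_singleton_self _)
    obtain ⟨r, hr, h⟩ := hE zeroVec
    rw [hX1, sum_singleton, twist_zeroVec_right, mul_one] at h
    have hZ : 8 * u' zeroVec = 16 * sZ (g zeroVec) + r * 64 - π x₁ := by exact_mod_cast h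
    have hs := hsg zeroVec
    omega
  · obtain ⟨x₁, x₂, hne12, hX2⟩ := card_eq_two.1 hc
    have hx₁ := hpm x₁ (by rw [hX2]; simp)
    have hx₂ := hpm x₂ (by rw [hX2]; simp)
    obtain ⟨yS, hyS⟩ := es_exists_twist_neg (a := bxor x₁ x₂) (fun h => hne12 ((bxor_eq_zeroVec_iff x₁ x₂).1 h))
    rw [twist_bxor_left] at hyS
    obtain ⟨r₀, hr₀, h₀⟩ := hE zeroVec
    obtain ⟨r₁, hr₁, h₁⟩ := hE yS
    rw [hX2, sum_pair hne12, twist_zeroVec_right, twist_zeroVec_right, mul_one, mul_one] at h₀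
    rw [hX2, sum_pair hne12] at h₁
    have hZ0 : 8 * u' zeroVec = 16 * sZ (g zeroVec) + r₀ * 64 - (π x₁ + π x₂) := by exact_mod_cast h₀
    rcases Simon.twist_eq_one_or x₁ yS with ht | ht
    · have ht2 : twist x₂ yS = -1 := by rw [ht] at hyS; linarith
      rw [ht, ht2] at h₁
      have hZ1 : 8 * u' yS = 16 * sZ (g yS) + r₁ * 64 - (π x₁ - π x₂) := by
        have : ((8 * u' yS : ℤ) : ℝ) = 16 * (sZ (g yS) : ℝ) + (r₁ : ℝ) * 64 - (((π x₁ : ℤ) : ℝ) - ((π x₂ : ℤ) : ℝ)) := by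
          rw [h₁]; ring
        exact_mod_cast this
      have hp0 := hpc yS zeroVec
      rw [Int.odd_iff, Int.odd_iff] at hp0
      have hs := hsg zeroVec; have hs' := hsg yS
      omega
    · have ht2 : twist x₂ yS = 1 := by rw [ht] at hyS; linarith
      rw [ht, ht2] at h₁
      have hZ1 : 8 * u' yS = 16 * sZ (g yS) + r₁ * 64 - (-π x₁ + π x₂) := by
        have : ((8 * u' yS : ℤ) : ℝ) = 16 * (sZ (g yS) : ℝ) + (r₁ : ℝ) * 64 - (-((π x₁ : ℤ) : ℝ) + ((π x₂ : ℤ) : ℝ)) := by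
          rw [h₁]; ring
        exact_mod_cast this
      have hp0 := hpc yS zeroVec
      rw [Int.odd_iff, Int.odd_iff] at hp0
      have hs := hsg zeroVec; have hs' := hsg yS
      omega
  · obtain ⟨x₁, x₂, x₃, h12, h13, h23, hX3⟩ := card_eq_three.1 hc
    have hx₁ := hpm x₁ (by rw [hX3]; simp)
    have hx₂ := hpm x₂ (by rw [hX3]; simp)
    have hx₃ := hpm x₃ (by rw [hX3]; simp)
    obtain ⟨r, hr, h⟩ := hE zeroVec
    rw [hX3, sum_insert (by simp [h12, h13]), sum_pair h23, twist_zeroVec_right, twist_zeroVec_right, twist_zeroVec_right,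
      mul_one, mul_one, mul_one] at h
    have hZ : 8 * u' zeroVec = 16 * sZ (g zeroVec) + r * 64 - (π x₁ + (π x₂ + π x₃)) := by exact_mod_cast h
    have hs := hsg zeroVec
    omega

/-- **Clean kill (T5):** if every `π` vanishes then `Σ_Z v·ℓ = −32`, but `|Σ_Z v·ℓ| ≤ 16`. [this work] -/
theorem tef_clean (f g : (Fin (4 + 4) → Bool) → Bool) (v : (Fin (4 + 4) → Bool) → ℤ)
    (hv : ∀ x, W (fun y => signOf (g y)) x = (2 : ℝ) ^ 4 * (v x : ℝ)) (hN : #(univ.filter fun x => Odd (v x)) = 192)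
    (A : (Fin (4 + 4) → Bool) → ℝ) (hA : ∀ y, ∃ r : ℤ, (r = 0 ∨ r = 1 ∨ r = -1) ∧ A y = (r : ℝ) * 64)
    (hAW : ∀ y, W (fun x => ((if Odd (v x) then (0 : ℤ) else sZ (decide (Odd (v x / 2)) ^^ f x)) : ℝ)) y = A y)
    (hπ : ∀ y, v y - sZ (f y) + (if Odd (v y) then 0 else sZ (decide (Odd (v y / 2)) ^^ f y)) = 0) : False := by
  classical
  -- abbreviations as functions
  have hG1 : ∀ y, ((if Odd (v y) then (0 : ℤ) else sZ (decide (Odd (v y / 2)) ^^ f y)) : ℤ) ^ 2 =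
      if Odd (v y) then 0 else 1 := by
    intro y; by_cases h : Odd (v y)
    · simp [h]
    · simp only [h, if_false]; rcases tp_sZ_cases (decide (Odd (v y / 2)) ^^ f y) with h' | h' <;> rw [h'] <;> norm_num
  have h64 : ∑ y, (if Odd (v y) then (0 : ℤ) else 1) = 64 := by
    rw [sum_ite, sum_const_zero, zero_add, sum_const, nsmul_eq_mul, mul_one]
    have := card_filter_add_card_filter_not (s := (univ : Finset (Fin (4 + 4) → Bool))) (fun x => Odd (v x))
    rw [hN, card_univ, Fintype.card_fun, Fintype.card_bool, Fintype.card_fin] at this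
    simp only [Nat.reducePow, Nat.reduceAdd] at this
    exact_mod_cast Nat.add_left_cancel (this.trans (by norm_num))
  have hE := el_sum_sq g v hv
  -- Σ v·G = −32
  have h256 : ∑ y : Fin (4 + 4) → Bool, (1 : ℤ) = 256 := by simp
  have hvG : ∑ y, v y * (if Odd (v y) then (0 : ℤ) else sZ (decide (Odd (v y / 2)) ^^ f y)) = -32 := by
    have e2 : ∀ y, v y ^ 2 = 1 - 2 * (sZ (f y) * (if Odd (v y) then (0 : ℤ) else sZ (decide (Odd (v y / 2)) ^^ f y))) +
        (if Odd (v y) then (0 : ℤ) else 1) := by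
      intro y
      have hs : sZ (f y) ^ 2 = 1 := by rcases tp_sZ_cases (f y) with h | h <;> rw [h] <;> norm_num
      have hG := hG1 y
      have hπy := hπ y
      rw [← hG]
      linear_combination (v y + sZ (f y) - (if Odd (v y) then (0 : ℤ) else sZ (decide (Odd (v y / 2)) ^^ f y))) * hπy + hs
    have e3 : ∀ y, v y * (if Odd (v y) then (0 : ℤ) else sZ (decide (Odd (v y / 2)) ^^ f y)) =
        sZ (f y) * (if Odd (v y) then (0 : ℤ) else sZ (decide (Odd (v y / 2)) ^^ f y)) - (if Odd (v y) then (0 : ℤ) else 1) := by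
      intro y
      have hG := hG1 y
      have hπy := hπ y
      rw [← hG]
      linear_combination (if Odd (v y) then (0 : ℤ) else sZ (decide (Odd (v y / 2)) ^^ f y)) * hπy
    rw [sum_congr rfl fun y _ => e2 y, sum_add_distrib, sum_sub_distrib, ← mul_sum, h64, h256] at hE
    rw [sum_congr rfl fun y _ => e3 y, sum_sub_distrib, h64]
    linarith
  -- Σ v·G = (1/16) Σ_z S_g(z) W_G(z)
  have hvW : ((∑ y, v y * (if Odd (v y) then (0 : ℤ) else sZ (decide (Odd (v y / 2)) ^^ f y)) : ℤ) : ℝ) =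
      (1 / 16) * ∑ z, signOf (g z) * A z := by
    have hv' : ∀ y, (v y : ℝ) = (1 / 16) * ∑ z, signOf (g z) * twist z y := by
      intro y; have := hv y; unfold W at this; rw [this]; ring
    push_cast
    simp_rw [hv', ← hAW]
    unfold W
    simp_rw [mul_sum, sum_mul]
    rw [sum_comm]
    refine sum_congr rfl fun z _ => sum_congr rfl fun y _ => ?_
    rw [twist_comm z y]; ring
  have hP : ∑ z, A z ^ 2 = 2 ^ 8 * 64 := by
    have hsq := sum_W_sq (fun x => ((if Odd (v x) then (0 : ℤ) else sZ (decide (Odd (v x / 2)) ^^ f x)) : ℝ))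
    simp_rw [hAW] at hsq
    have hG : ((∑ y, ((if Odd (v y) then (0 : ℤ) else sZ (decide (Odd (v y / 2)) ^^ f y)) : ℤ) ^ 2 : ℤ) : ℝ) = 64 := by
      rw [sum_congr rfl fun y _ => hG1 y, h64]; norm_num
    push_cast at hG hsq
    rw [hsq, hG]
  have hT : ∀ z, A z = 0 ∨ A z = 64 ∨ A z = -64 := by
    intro z; obtain ⟨r, hr, h⟩ := hA z
    rcases hr with rfl | rfl | rfl
    · left; rw [h]; simp
    · right; left; rw [h]; simp
    · right; right; rw [h]; simp
  have habs := tep_abs_sum_le A (fun z => signOf (g z)) hT hP (fun z => by unfold signOf; split_ifs <;> simp)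
  have h32 : ((∑ y, v y * (if Odd (v y) then (0 : ℤ) else sZ (decide (Odd (v y / 2)) ^^ f y)) : ℤ) : ℝ) = -32 := by
    exact_mod_cast hvG
  rw [hvW] at h32
  have := abs_le.1 habs
  linarith [this.1, this.2]

end Summit.QuantumAdvantage.QuantumAdvantage.Theorems.CubicForrelation.NearExactIsExact

end
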